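import Mathlib.GroupTheory.FiniteAbelian.Basic
import Literature.NumberTheory.GaloisRepresentations.ProfiniteIntersectionCocycleExtension
import HarnessLib

/-!
# `H²(⋂ₖ Sₖ, D) = 0` from `H²(Sₖ, D) = 0` for a discrete TORSION module with trivial action

Topic `NumberTheory/GaloisRepresentations` (continuous cohomology of profinite groups); namespace
`Literature.NumberTheory.GaloisRepresentations`.  Theorems only (no definition, no named fact, no
instance; D-0026).

Let `G` be a profinite group (compact, Hausdorff, totally disconnected), `S₀ ⊇ S₁ ⊇ ⋯` a decreasing
sequence of closed subgroups with intersection `S_∞ = ⨅ₖ Sₖ`, and `D` a DISCRETE abelian group which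
is TORSION (every element of finite order — e.g. `ℚ_p/ℤ_p`, `μ_{p^∞}`, any finite group), viewed
with the trivial action of every subgroup (`ContinuousRep.trivial`), over any commutative topological
coefficient ring `R` acting continuously on `D` (the ring is inert: the cochains and the cocycle and
coboundary identities do not see it).

* `subsingleton_H2_trivial_iInf_of_forall` — **if `H²(Sₖ, D) = 0` for every `k`, then
  `H²(S_∞, D) = 0`.**

This is the vanishing half of the continuity of cohomology `H²(⋂ Sₖ, D) = lim→ H²(Sₖ, D)` (Serre,
*Cohomologie galoisienne*, I §2.2 Prop. 8) for an INFINITE discrete torsion module, reduced to the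
tree's finite-coefficient extension theorem `exists_cocycle_extension_of_iInf`
(`ProfiniteIntersectionCocycleExtension.lean`): a continuous inhomogeneous `2`-cocycle
`c : S_∞ × S_∞ → D` has finite image (compact source, discrete target), so it takes values in the
FINITE subgroup `A = ⟨im c⟩ ≤ D` (finitely generated and torsion); as an `A`-valued cocycle it
extends to some `Sₖ` (loc. cit.), the extension pushed into `D` is a coboundary `δb` there by
hypothesis (`twoCocycleClass_eq_zero_iff`), and restricting the continuous `1`-cochain `b` to `S_∞`
exhibits `c` as a coboundary.

USE: the reduction of weak Leopoldt statements for a `ℤ_p^m`-extension containing the cyclotomic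
one to the layers of the tower (Greenberg 2006 pp. 343–344 / Nguyen Quang Do 1984 Thm. 2.2 ⇐ the
cyclotomic case), where the coefficient module is `ℚ_p/ℤ_p` with the trivial action
(`Literature/NumberTheory/IwasawaTheory/Greenberg2006/`).  HONEST FRAMING: textbook profinite
cohomology; nothing arithmetic is proved here.

## References

* J.-P. Serre, *Cohomologie galoisienne*, LNM 5 / *Galois Cohomology* (1997), I §2.2 Prop. 8 and
  Cor. 1. [SerreGaloisCohomology1997]
* S. S. Shatz, *Profinite groups, arithmetic, and geometry* (1972), Ch. II §2. [Shatz1972]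
-/

noncomputable section

open CategoryTheory Topology Filter

namespace Literature.NumberTheory.GaloisRepresentations

open _root_.TopRep _root_.ContRepresentation _root_.ContinuousCohomology

universe u


section Profinite

variable {G : Type u} [Group G] [TopologicalSpace G] [IsTopologicalGroup G] [CompactSpace G]
  [T2Space G] [TotallyDisconnectedSpace G]
variable {R : Type u} [CommRing R] [TopologicalSpace R] [IsTopologicalRing R]
variable {D : Type u} [AddCommGroup D] [Module R D] [TopologicalSpace D] [DiscreteTopology D]
  [ContinuousSMul R D]

omit [TotallyDisconnectedSpace G] [T2Space G] in
/-- The subgroup generated by the values of a continuous map from a compact space to a discrete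
torsion abelian group is finite (finite image; a finitely generated torsion abelian group is finite).
[folklore] -/
private theorem finite_closure_range_of_isTorsion (htors : AddMonoid.IsTorsion D) {X : Type*}
    [TopologicalSpace X] [CompactSpace X] (f : C(X, D)) :
    Finite (AddSubgroup.closure (Set.range f)) := by
  have hfin : (Set.range f).Finite := (isCompact_range f.continuous).finite_of_discrete
  haveI : Finite (Set.range f) := hfin.to_subtype
  haveI : AddGroup.FG (AddSubgroup.closure (Set.range f)) := AddGroup.closure_finite_fg _
  exact AddCommGroup.finite_of_fg_torsion _ (IsTorsion.addSubgroup htors _)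

omit [IsTopologicalRing R] in
/-- **`H²(⋂ₖ Sₖ, D) = 0` from `H²(Sₖ, D) = 0`** for a decreasing sequence of closed subgroups `Sₖ` of
a profinite group and a discrete torsion abelian group `D` with the trivial action (any inert
coefficient ring `R`): the vanishing half of `H²(⋂ Sₖ, D) = lim→ H²(Sₖ, D)`.
[cite: SerreGaloisCohomology1997, I §2.2 Prop. 8 and Cor. 1] [cite: Shatz1972, Ch. II §2] -/
theorem subsingleton_H2_trivial_iInf_of_forall (htors : AddMonoid.IsTorsion D)
    (S : ℕ → Subgroup G) (hS : Antitone S) (hcl : ∀ k, IsClosed ((S k : Subgroup G) : Set G))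
    (h : ∀ k, Subsingleton (continuousCohomology 2 (ContinuousRep.trivial (S k) R D).toTopRep)) :
    Subsingleton (continuousCohomology 2 (ContinuousRep.trivial (⨅ k, S k : Subgroup G) R D).toTopRep) := by
  classical
  have hcl' : IsClosed (((⨅ k, S k : Subgroup G)) : Set G) := by
    rw [Subgroup.coe_iInf]
    exact isClosed_iInter hcl
  -- closed subgroups of the compact `G` are compact (Hausdorff), hence locally compact
  haveI : CompactSpace (⨅ k, S k : Subgroup G) := isCompact_iff_compactSpace.mp hcl'.isCompact
  haveI : ∀ k, CompactSpace (S k) := fun k ↦ isCompact_iff_compactSpace.mp (hcl k).isCompact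
  refine subsingleton_of_forall_eq 0 fun x => ?_
  obtain ⟨c, rfl⟩ := twoCocycleClass_surjective _ x
  -- the finite subgroup `A = ⟨im c⟩ ≤ D`
  set A : AddSubgroup D := AddSubgroup.closure (Set.range c.1) with hA
  haveI : Finite A := finite_closure_range_of_isTorsion htors c.1
  have hmem : ∀ q, c.1 q ∈ A := fun q => AddSubgroup.subset_closure ⟨q, rfl⟩
  -- `c` as an `A`-valued cocycle of the trivial `ℤ`-representation of `G` restricted to `S_∞`
  let ρA : ContinuousRep G ℤ A := ContinuousRep.trivial G ℤ A
  let cA : contTwoCocycles ((ρA.restrict (subgroupIncl (⨅ k, S k))).toTopRep) :=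
    ⟨⟨fun q => ⟨c.1 q, hmem q⟩, c.1.continuous.subtype_mk _⟩, fun σ τ υ => by
      apply Subtype.ext
      have hc := c.2 σ τ υ
      rw [ContinuousRep.toTopRep_ρ_apply, ContinuousRep.trivial_apply] at hc
      rw [ContinuousRep.toTopRep_ρ_apply, ContinuousRep.restrict_apply, subgroupIncl_apply,
        ContinuousRep.trivial_apply]
      simpa using hc⟩
  -- extend it to some `S k`
  obtain ⟨k, c', hc'⟩ := exists_cocycle_extension_of_iInf ρA S hS hcl cA
  -- push the extension into `D`: a cocycle of the trivial `R`-representation of `S k`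
  let cD : contTwoCocycles (ContinuousRep.trivial (S k) R D).toTopRep :=
    ⟨⟨fun q => ((c'.1 q : A) : D), continuous_subtype_val.comp c'.1.continuous⟩, fun σ τ υ => by
      have hc := congrArg (fun a : A => (a : D)) (c'.2 σ τ υ)
      simp only [AddSubgroup.coe_add] at hc
      rw [ContinuousRep.toTopRep_ρ_apply, ContinuousRep.trivial_apply]
      exact hc⟩
  -- which is a coboundary, `H²(S k, D)` being zero
  have hzero : twoCocycleClass _ cD = 0 := by
    haveI := h k
    exact Subsingleton.elim _ _
  obtain ⟨b, hb⟩ := (twoCocycleClass_eq_zero_iff _ cD).1 hzero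
  -- restrict the splitting cochain to `S_∞`
  refine (twoCocycleClass_eq_zero_iff _ c).2 ⟨b.comp ⟨Subgroup.inclusion (iInf_le S k),
    continuous_inclusion (iInf_le S k)⟩, fun σ τ => ?_⟩
  have h1 : c.1 (σ, τ) = ((cA.1 (σ, τ) : A) : D) := rfl
  have h2 : cA.1 (σ, τ) = c'.1 (Subgroup.inclusion (iInf_le S k) σ,
      Subgroup.inclusion (iInf_le S k) τ) := (hc' σ τ).symm
  have h3 := hb (Subgroup.inclusion (iInf_le S k) σ) (Subgroup.inclusion (iInf_le S k) τ)
  rw [ContinuousRep.toTopRep_ρ_apply, ContinuousRep.trivial_apply] at h3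
  rw [ContinuousRep.toTopRep_ρ_apply, ContinuousRep.trivial_apply, h1, h2]
  change (cD.1 _ : D) = _
  rw [h3, ← map_mul]
  rfl

end Profinite


/-! ### Appendix (2026-08-28, same seat): the coefficient ring is inert; the KILLING form of the
### criterion (classes of the finite stages need only die DEEPER, after enlarging the coefficients)

For the weak-Leopoldt assembly the hypothesis "`H²(Sₖ, D) = 0` for every `k`" of
`subsingleton_H2_trivial_iInf_of_forall` is too strong (for `Sₖ = G_S(F_k)` and `D = ℚ_p/ℤ_p` it is
Leopoldt's conjecture for the number field `F_k`); what the tower argument supplies is: every class of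
`H²(Sₖ, A)` with coefficients in a FINITE subgroup `A ≤ D` dies in `H²(S_{k'}, D)` for some `k' ≥ k`
(Serre I §2.2 Prop. 8: `H²(⋂ Sₖ, D) = lim→ₖ lim→_A H²(Sₖ, A)`).  This appendix proves that form
(`subsingleton_H2_trivial_iInf_of_forall_exists`, over `ℤ`) together with the transport between
coefficient rings (`subsingleton_H2_trivial_iff_int`: for the TRIVIAL action the continuous
`2`-cocycles and coboundaries do not see the ring). -/

section RingInert

variable {H : Type u} [Group H] [TopologicalSpace H] [IsTopologicalGroup H] [LocallyCompactSpace H]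
variable {R₁ : Type*} [CommRing R₁] [TopologicalSpace R₁]
variable {R₂ : Type*} [CommRing R₂] [TopologicalSpace R₂]
variable {D : Type u} [AddCommGroup D] [TopologicalSpace D] [DiscreteTopology D]

/-- For the trivial action, `H²(H, D) = 0` over one coefficient ring implies it over any other: a
continuous inhomogeneous `2`-cocycle (resp. a splitting `1`-cochain) over `R₂` is literally one over
`R₁`. [cite: SerreGaloisCohomology1997, I §2.3] -/
theorem subsingleton_H2_trivial_of_ring [Module R₁ D] [ContinuousSMul R₁ D] [Module R₂ D]
    [ContinuousSMul R₂ D]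
    (h : Subsingleton (continuousCohomology 2 (ContinuousRep.trivial H R₁ D).toTopRep)) :
    Subsingleton (continuousCohomology 2 (ContinuousRep.trivial H R₂ D).toTopRep) := by
  refine subsingleton_of_forall_eq 0 fun x => ?_
  obtain ⟨c, rfl⟩ := twoCocycleClass_surjective _ x
  -- the same function as a cocycle over `R₁`
  let c₁ : contTwoCocycles (ContinuousRep.trivial H R₁ D).toTopRep :=
    ⟨c.1, fun σ τ υ => by
      have hc := c.2 σ τ υ
      rw [ContinuousRep.toTopRep_ρ_apply, ContinuousRep.trivial_apply] at hc
      rw [ContinuousRep.toTopRep_ρ_apply, ContinuousRep.trivial_apply]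
      exact hc⟩
  have h0 : twoCocycleClass _ c₁ = 0 := by
    haveI := h
    exact Subsingleton.elim _ _
  obtain ⟨b, hb⟩ := (twoCocycleClass_eq_zero_iff _ c₁).1 h0
  refine (twoCocycleClass_eq_zero_iff _ c).2 ⟨b, fun σ τ => ?_⟩
  have h1 := hb σ τ
  rw [ContinuousRep.toTopRep_ρ_apply, ContinuousRep.trivial_apply] at h1
  rw [ContinuousRep.toTopRep_ρ_apply, ContinuousRep.trivial_apply]
  exact h1

/-- `H²(H, D) = 0` for the trivial action does not depend on the (inert) coefficient ring: over `R`
iff over `ℤ`. [cite: SerreGaloisCohomology1997, I §2.3] -/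
theorem subsingleton_H2_trivial_iff_int [Module R₁ D] [ContinuousSMul R₁ D] :
    Subsingleton (continuousCohomology 2 (ContinuousRep.trivial H R₁ D).toTopRep) ↔
      Subsingleton (continuousCohomology 2 (ContinuousRep.trivial H ℤ D).toTopRep) :=
  ⟨fun h => subsingleton_H2_trivial_of_ring h, fun h => subsingleton_H2_trivial_of_ring h⟩

end RingInert

section Killing

variable {G : Type u} [Group G] [TopologicalSpace G] [IsTopologicalGroup G] [CompactSpace G]
  [T2Space G] [TotallyDisconnectedSpace G]
variable {D : Type u} [AddCommGroup D] [TopologicalSpace D] [DiscreteTopology D]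

/-- **`H²(⋂ₖ Sₖ, D) = 0` in KILLING form** (decreasing closed subgroups `Sₖ` of a profinite group,
`D` a discrete torsion abelian group with the trivial action, cohomology over `ℤ`): if every
continuous `2`-cocycle of every `Sₖ` with values in a FINITE subgroup `A ≤ D` becomes, restricted to some
`S_{k'}` (`k' ≥ k`) and read in `D`, the coboundary of a continuous `1`-cochain — i.e. its class dies in
`H²(S_{k'}, D)` (`twoCocycleClass_eq_zero_iff`) — then `H²(⋂ₖ Sₖ, D) = 0`.  (With `D` finite and `A = D`
this is the tree's `subsingleton_two_iInf_of_forall_exists_resSub_eq_zero`; with the stronger hypothesis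
"`H²(Sₖ, D) = 0`" it is `subsingleton_H2_trivial_iInf_of_forall`.)
[cite: SerreGaloisCohomology1997, I §2.2 Prop. 8 and Cor. 1]
[cite: Shatz1972, Ch. II §2] -/
theorem subsingleton_H2_trivial_iInf_of_forall_exists (htors : AddMonoid.IsTorsion D)
    (S : ℕ → Subgroup G) (hS : Antitone S) (hcl : ∀ k, IsClosed ((S k : Subgroup G) : Set G))
    (hkill : ∀ (k : ℕ) (A : AddSubgroup D) [Finite A]
      (c : contTwoCocycles (((ContinuousRep.trivial G ℤ A).restrict (subgroupIncl (S k))).toTopRep)),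
      ∃ (k' : ℕ) (hkk' : k ≤ k') (b : C(S k', D)), ∀ σ τ : S k',
        ((c.1 (Subgroup.inclusion (hS hkk') σ, Subgroup.inclusion (hS hkk') τ) : A) : D) =
          b τ - b (σ * τ) + b σ) :
    Subsingleton (continuousCohomology 2 (ContinuousRep.trivial (⨅ k, S k : Subgroup G) ℤ D).toTopRep) := by
  classical
  have hcl' : IsClosed (((⨅ k, S k : Subgroup G)) : Set G) := by
    rw [Subgroup.coe_iInf]
    exact isClosed_iInter hcl
  haveI : CompactSpace (⨅ k, S k : Subgroup G) := isCompact_iff_compactSpace.mp hcl'.isCompact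
  haveI : ∀ k, CompactSpace (S k) := fun k ↦ isCompact_iff_compactSpace.mp (hcl k).isCompact
  refine subsingleton_of_forall_eq 0 fun x => ?_
  obtain ⟨c, rfl⟩ := twoCocycleClass_surjective _ x
  -- the finite subgroup `A = ⟨im c⟩ ≤ D`
  set A : AddSubgroup D := AddSubgroup.closure (Set.range c.1) with hA
  haveI : Finite A := finite_closure_range_of_isTorsion htors c.1
  have hmem : ∀ q, c.1 q ∈ A := fun q => AddSubgroup.subset_closure ⟨q, rfl⟩
  -- `c` as an `A`-valued cocycle of the trivial `ℤ`-representation of `G` restricted to `S_∞`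
  let ρA : ContinuousRep G ℤ A := ContinuousRep.trivial G ℤ A
  let cA : contTwoCocycles ((ρA.restrict (subgroupIncl (⨅ k, S k))).toTopRep) :=
    ⟨⟨fun q => ⟨c.1 q, hmem q⟩, c.1.continuous.subtype_mk _⟩, fun σ τ υ => by
      apply Subtype.ext
      have hc := c.2 σ τ υ
      rw [ContinuousRep.toTopRep_ρ_apply, ContinuousRep.trivial_apply] at hc
      rw [ContinuousRep.toTopRep_ρ_apply, ContinuousRep.restrict_apply, subgroupIncl_apply,
        ContinuousRep.trivial_apply]
      simpa using hc⟩
  -- extend it to some `S k`, then kill it deeper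
  obtain ⟨k, c', hc'⟩ := exists_cocycle_extension_of_iInf ρA S hS hcl cA
  obtain ⟨k', hkk', b, hb⟩ := hkill k A c'
  -- restrict the splitting cochain from `S k'` to `S_∞`
  refine (twoCocycleClass_eq_zero_iff _ c).2 ⟨b.comp ⟨Subgroup.inclusion (iInf_le S k'),
    continuous_inclusion (iInf_le S k')⟩, fun σ τ => ?_⟩
  have h1 : c.1 (σ, τ) = ((cA.1 (σ, τ) : A) : D) := rfl
  have h2 : cA.1 (σ, τ) = c'.1 (Subgroup.inclusion (iInf_le S k) σ,
      Subgroup.inclusion (iInf_le S k) τ) := (hc' σ τ).symm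
  have h3 := hb (Subgroup.inclusion (iInf_le S k') σ) (Subgroup.inclusion (iInf_le S k') τ)
  rw [ContinuousRep.toTopRep_ρ_apply, ContinuousRep.trivial_apply, h1, h2]
  -- `inclusion (S k' ≤ S k) ∘ inclusion (S_∞ ≤ S k') = inclusion (S_∞ ≤ S k)`
  have e1 : Subgroup.inclusion (hS hkk') (Subgroup.inclusion (iInf_le S k') σ) =
      Subgroup.inclusion (iInf_le S k) σ := rfl
  have e2 : Subgroup.inclusion (hS hkk') (Subgroup.inclusion (iInf_le S k') τ) =
      Subgroup.inclusion (iInf_le S k) τ := rfl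
  rw [e1, e2] at h3
  rw [h3, ← map_mul]
  rfl

/-- The killing form with the conclusion over ANY inert coefficient ring `R`.
[cite: SerreGaloisCohomology1997, I §2.2 Prop. 8] -/
theorem subsingleton_H2_trivial_iInf_of_forall_exists' (htors : AddMonoid.IsTorsion D)
    {R : Type*} [CommRing R] [TopologicalSpace R] [Module R D] [ContinuousSMul R D]
    (S : ℕ → Subgroup G) (hS : Antitone S) (hcl : ∀ k, IsClosed ((S k : Subgroup G) : Set G))
    (hkill : ∀ (k : ℕ) (A : AddSubgroup D) [Finite A]
      (c : contTwoCocycles (((ContinuousRep.trivial G ℤ A).restrict (subgroupIncl (S k))).toTopRep)),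
      ∃ (k' : ℕ) (hkk' : k ≤ k') (b : C(S k', D)), ∀ σ τ : S k',
        ((c.1 (Subgroup.inclusion (hS hkk') σ, Subgroup.inclusion (hS hkk') τ) : A) : D) =
          b τ - b (σ * τ) + b σ) :
    Subsingleton (continuousCohomology 2 (ContinuousRep.trivial (⨅ k, S k : Subgroup G) R D).toTopRep) := by
  have hcl' : IsClosed (((⨅ k, S k : Subgroup G)) : Set G) := by
    rw [Subgroup.coe_iInf]
    exact isClosed_iInter hcl
  haveI : CompactSpace (⨅ k, S k : Subgroup G) := isCompact_iff_compactSpace.mp hcl'.isCompact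
  exact subsingleton_H2_trivial_of_ring
    (subsingleton_H2_trivial_iInf_of_forall_exists htors S hS hcl hkill)

end Killing

end Literature.NumberTheory.GaloisRepresentations

end
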